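import Mathlib
import Summits.NavierStokesRegularity.NavierStokesRegularity.Theses.SubcriticalEnvelope
import Summits.NavierStokesRegularity.NavierStokesRegularity.Theorems.SubOnsagerCeilingDefs
import Summits.NavierStokesRegularity.NavierStokesRegularity.Theorems.SubOnsagerCeilingOrthantInvariance
import HarnessLib

/-!
# `SubcriticalEnvelope.ViscousTailEnvelope` (stmt-NavierStokesRegularity-26128) — the ORTHANT HALF
(helper file, `--supports`; idea-crit-3 J r2 price P2: "land the implication
`OrthantTailCeiling` + cone invariance ⇒ A‴ on orthant tables as a support theorem, so the
dependence on stmt-25507 is in the cone, not in prose")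

The crux A‴ = `ViscousTailEnvelope` asks, for every spread `R ≥ 1`, a threshold `εs(R)` and, for
every scale ratio `1+ε₀` with `ε₀ ≤ εs`, every comparable table `α ∈ E₂(R)` and every one-shell
datum `X₀`, a margin `η > 0` and window-wise constants `C(T)` UNIFORM IN THE VISCOSITY `ν > 0`
bounding the tail energy `Σ_{k=n..N} Σ_i ½X_{i,k}(t)²` of every honest `ν`-damped lattice solution
on `[0,s] ⊆ [0,T]` by `C·(1+ε₀)^{-(1+η)n}`.  This file settles the ORTHANT conjunct of A‴ modulo
the sibling crux `SubOnsagerCeiling.OrthantTailCeiling` (stmt-25507) and lands the case-split glue: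

* `viscousTailEnvelopeOrthant_uniform_of_ceilingAt` (per table, the strong form): if ONE table
  `α ∈ E₂(R)` satisfying the Kamke orthant condition has the sub-Onsager tail ceiling
  `CeilingAt R ε₀ α` (`θ > 1/2`, `C ≥ 0`, for the honest viscous solutions that are non-negative on
  shells `≥ 1`), then EVERY honest `ν`-viscous solution from any one-shell datum obeys
  `Σ_{k=n..N} Σ_i ½X_{i,k}(t)² ≤ C·E₀·(1+ε₀)^{-(1+η)n}` with `η := 2θ − 1 > 0`, uniformly in `ν`,
  in the datum (through `E₀ = Σ_i ½X₀_i²` only) and in the window: Kamke forward invariance of the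
  positive cone (tree theorem `subOnsagerCeiling_orthantInvariance_proof`, shared with
  `orthantInvariance_proof`) supplies the sign hypothesis of the ceiling, and
  `2θ·n = (1+η)·n`;
* `viscousTailEnvelope_orthantHalf_of_ceilingOn` / `…_of_orthantTailCeiling`: the A‴ quantifier
  shape (`∃ εs ∀ ε₀ ≤ εs ∀ α ∀ X₀ ∃ η ∀ T ∃ C ∀ ν`) restricted to orthant tables — of an arbitrary
  sub-class `P` on which the ceiling is known, resp. of all of `E₂(R)` under `OrthantTailCeiling` —
  with `εs = 1`;
* `viscousTailEnvelope_of_orthantHalf_of_mixingHalf`: the orthant half and the sign-mixing half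
  (same shape with the NEGATED orthant condition) give `ViscousTailEnvelope` (threshold
  `min εs₁ εs₂`, case split on the orthant predicate — the split of `SubOnsagerCeiling.closes`);
* `viscousTailEnvelope_of_orthantTailCeiling_of_mixingHalf`: hence `OrthantTailCeiling` and the
  sign-mixing half give A‴.

The SIGN-MIXING half is NOT touched here (it is the declared new content of A‴ = residual
`NonOrthantBreak` in envelope form; no instrument row exists for it yet, idea-crit-3 P1).

HONEST FRAMING: statements about Tao-type MODEL lattice ODEs (route SubcriticalEnvelope, rung
TL-M2Break); `OrthantTailCeiling` / `CeilingAt` are OPEN hypotheses of the sibling route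
SubOnsagerCeiling (and may need re-typing to a sub-class of orthant tables — whence the
class-restricted form); nothing here bears on the Navier–Stokes equations or their regularity, and
no summit is proved.
-/

noncomputable section

-- the sub-problem namespace `NavierStokesRegularity.NavierStokesRegularity` is the tree's layout (D-0017)
set_option linter.dupNamespace false

namespace Summit.NavierStokesRegularity.NavierStokesRegularity.Theorems

open Set
open Literature.Analysis.FluidPDE.TaoCascade
open Summit.NavierStokesRegularity.NavierStokesRegularity.Theses

/-- Exponent bookkeeping: with `η = 2θ − 1`, `-(1+η)·n = -2θ·n`. [this file] -/
theorem viscousTailEnvelopeOrthant_exponent (θ : ℝ) (n : ℕ) :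
    -((1 + (2 * θ - 1)) * (n : ℝ)) = -(2 * θ * (n : ℝ)) := by
  ring

/-- **Orthant envelope, per table, uniform form.** Let `ε₀ > 0` and let `α ∈ E₂(R)` satisfy the
Kamke orthant (quasi-positivity) condition.  If `α` has the sub-Onsager tail ceiling
`CeilingAt R ε₀ α` of route SubOnsagerCeiling (exponent `θ > 1/2`, constant `C ≥ 0`, for honest
viscous solutions non-negative on shells `≥ 1`), then there are `η > 0` (namely `2θ − 1`) and
`C ≥ 0` such that for EVERY viscosity `ν > 0`, every one-shell datum `X₀`, every window `[0,s]` and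
every honest `ν`-viscous lattice solution `X` on `[0,s]` (one-shell datum, zero below the datum
shell, (4.5)-weighted-bounded, continuous, exact damped ODE within `[0,s]`):
`Σ_{k=n..N} Σ_i ½X_{i,k}(t)² ≤ C·(Σ_i ½X₀_i²)·(1+ε₀)^{-(1+η)n}` for all `n ≤ N`, `t ∈ [0,s]`.
The sign hypothesis of the ceiling is discharged by Kamke cone invariance
(`subOnsagerCeiling_orthantInvariance_proof`).  MODEL lattice statement. [this file] -/
theorem viscousTailEnvelopeOrthant_uniform_of_ceilingAt {R ε₀ : ℝ}
    {α : Fin 4 → Fin 4 → Fin 4 → ℤ × ℤ × ℤ → ℝ} (hε₀ : 0 < ε₀) (hα : InTableClass R α)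
    (hK : ∀ (Y : Fin 4 → ℤ → ℝ → ℝ) (τ : ℝ), (∀ (j : Fin 4) (k : ℤ), 1 ≤ k → 0 ≤ Y j k τ) →
      ∀ δ : ℝ, 0 < δ → ∀ (i : Fin 4) (n : ℤ), 1 ≤ n → Y i n τ = 0 → 0 ≤ quadTerm δ α Y i n τ)
    (hceil : SubOnsagerCeiling.CeilingAt R ε₀ α) :
    ∃ η : ℝ, 0 < η ∧ ∃ C : ℝ, 0 ≤ C ∧ ∀ ν : ℝ, 0 < ν → ∀ (X₀ : Fin 4 → ℝ) (s : ℝ), 0 < s →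
      ∀ X : Fin 4 → ℤ → ℝ → ℝ,
      (∀ (i : Fin 4) (k : ℤ), X i k 0 = if k = 0 then X₀ i else 0) →
      (∀ (i : Fin 4) (k : ℤ), k < 0 → ∀ t : ℝ, X i k t = 0) →
      (∃ M : ℝ, ∀ (t : ℝ) (i : Fin 4) (k : ℤ), (1 + (1 + ε₀) ^ ((10 : ℝ) * k)) * |X i k t| ≤ M) →
      (∀ (i : Fin 4) (k : ℤ), Continuous (X i k)) →
      (∀ (i : Fin 4) (k : ℤ), ∀ t ∈ Icc (0 : ℝ) s, HasDerivWithinAt (X i k)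
        (quadTerm ε₀ α X i k t - ν * (1 + ε₀) ^ ((2 : ℝ) * k) * X i k t) (Icc (0 : ℝ) s) t) →
      ∀ n N : ℕ, n ≤ N → ∀ t ∈ Icc (0 : ℝ) s,
        ∑ k ∈ Finset.Icc n N, ∑ i : Fin 4, (1 / 2 : ℝ) * X i (k : ℤ) t ^ 2 ≤
          C * (∑ i : Fin 4, (1 / 2 : ℝ) * X₀ i ^ 2) * (1 + ε₀) ^ (-((1 + η) * (n : ℝ))) := by
  obtain ⟨θ, hθ, C, hC0, H⟩ := hceil hα hK
  refine ⟨2 * θ - 1, by linarith, C, hC0,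
    fun ν hν X₀ s hs X hinit hlow hbd hcont hder n N hnN t ht => ?_⟩
  -- Kamke forward invariance of the positive cone: the solution is `≥ 0` on shells `≥ 1`
  have hnonneg : ∀ t ∈ Icc (0 : ℝ) s, ∀ (i : Fin 4) (k : ℤ), 1 ≤ k → 0 ≤ X i k t :=
    subOnsagerCeiling_orthantInvariance_proof ε₀ ν hε₀ hν α hK X₀ s hs X hinit hlow hbd hcont hder
  rw [viscousTailEnvelopeOrthant_exponent]
  exact H ν hν X₀ s hs X hinit hlow hbd hcont hder hnonneg n N hnN t ht

/-- **Orthant half of A‴ on a sub-class, in the A‴ quantifier shape.** Let `P` be any class of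
tables on which the sub-Onsager tail ceiling is known at every spread `R ≥ 1` and every scale
ratio `ε₀ ∈ (0,1]` (`P α → CeilingAt R ε₀ α`).  Then the clause of `ViscousTailEnvelope` holds for
the orthant tables of `E₂(R)` in `P`, with threshold `εs = 1`: for `ε₀ ≤ 1`, `α ∈ E₂(R)` orthant
with `P α`, and every one-shell datum `X₀` there is `η > 0` such that on every window `[0,T]` one
constant, uniform over all `ν > 0`, bounds the tail energy of every honest `ν`-viscous solution on
`[0,s]`, `s ≤ T`, by `C·(1+ε₀)^{-(1+η)n}` (here even `T`-uniform: `C = C_α·E₀`).  The class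
parameter anticipates a re-typing of the ceiling to a sub-class of orthant tables.
MODEL lattice statement. [this file] -/
theorem viscousTailEnvelope_orthantHalf_of_ceilingOn
    (P : (Fin 4 → Fin 4 → Fin 4 → ℤ × ℤ × ℤ → ℝ) → Prop)
    (hceil : ∀ R : ℝ, 1 ≤ R → ∀ ε₀ : ℝ, 0 < ε₀ → ε₀ ≤ 1 →
      ∀ α : Fin 4 → Fin 4 → Fin 4 → ℤ × ℤ × ℤ → ℝ, P α → SubOnsagerCeiling.CeilingAt R ε₀ α) :
    ∀ R : ℝ, 1 ≤ R → ∃ εs : ℝ, 0 < εs ∧ ∀ ε₀ : ℝ, 0 < ε₀ → ε₀ ≤ εs →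
      ∀ α : Fin 4 → Fin 4 → Fin 4 → ℤ × ℤ × ℤ → ℝ, InTableClass R α →
      (∀ (Y : Fin 4 → ℤ → ℝ → ℝ) (τ : ℝ), (∀ (j : Fin 4) (k : ℤ), 1 ≤ k → 0 ≤ Y j k τ) →
        ∀ δ : ℝ, 0 < δ → ∀ (i : Fin 4) (n : ℤ), 1 ≤ n → Y i n τ = 0 → 0 ≤ quadTerm δ α Y i n τ) →
      P α →
      ∀ X₀ : Fin 4 → ℝ, ∃ η : ℝ, 0 < η ∧ ∀ T : ℝ, 0 < T → ∃ C : ℝ, ∀ ν : ℝ, 0 < ν →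
      ∀ s ∈ Ioc (0 : ℝ) T, ∀ X : Fin 4 → ℤ → ℝ → ℝ,
      (∀ i k, X i k 0 = if k = 0 then X₀ i else 0) →
      (∀ i k, k < 0 → ∀ t, X i k t = 0) →
      (∃ M : ℝ, ∀ (t : ℝ) (i : Fin 4) (k : ℤ), (1 + (1 + ε₀) ^ ((10 : ℝ) * k)) * |X i k t| ≤ M) →
      (∀ i k, Continuous (X i k)) →
      (∀ i k, ∀ t ∈ Icc (0 : ℝ) s, HasDerivWithinAt (X i k)
        (quadTerm ε₀ α X i k t - ν * (1 + ε₀) ^ ((2 : ℝ) * k) * X i k t) (Icc 0 s) t) →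
      ∀ n N : ℕ, n ≤ N → ∀ t ∈ Icc (0 : ℝ) s,
        ∑ k ∈ Finset.Icc n N, ∑ i, (1 / 2) * X i (k : ℤ) t ^ 2 ≤
          C * (1 + ε₀) ^ (-((1 + η) * (n : ℝ))) := by
  intro R hR
  refine ⟨1, one_pos, fun ε₀ hε₀ hle α hα hK hP X₀ => ?_⟩
  obtain ⟨η, hη, C, _hC0, H⟩ :=
    viscousTailEnvelopeOrthant_uniform_of_ceilingAt hε₀ hα hK (hceil R hR ε₀ hε₀ hle α hP)
  refine ⟨η, hη, fun T _hT => ⟨C * (∑ i : Fin 4, (1 / 2 : ℝ) * X₀ i ^ 2),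
    fun ν hν s hs X hinit hlow hbd hcont hder n N hnN t ht => ?_⟩⟩
  exact H ν hν X₀ s hs.1 X hinit hlow hbd hcont hder n N hnN t ht

/-- **Orthant half of A‴ from `OrthantTailCeiling`.** If the sibling crux
`SubOnsagerCeiling.OrthantTailCeiling` (stmt-NavierStokesRegularity-25507) holds, then the clause
of `ViscousTailEnvelope` holds for every ORTHANT table of `E₂(R)`, every `R ≥ 1`, with threshold
`εs = 1` and margin `η = 2θ − 1` (`θ > 1/2` the ceiling exponent of the table): cone invariance of
shells `k ≥ 1` + the ceiling.  This is the orthant conjunct of the foreseen glued split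
A‴ ⇐ (orthant half) ∧ (sign-mixing half).  MODEL lattice statement; `OrthantTailCeiling` is an
open hypothesis. [this file] -/
theorem viscousTailEnvelope_orthantHalf_of_orthantTailCeiling
    (hceil : SubOnsagerCeiling.OrthantTailCeiling) :
    ∀ R : ℝ, 1 ≤ R → ∃ εs : ℝ, 0 < εs ∧ ∀ ε₀ : ℝ, 0 < ε₀ → ε₀ ≤ εs →
      ∀ α : Fin 4 → Fin 4 → Fin 4 → ℤ × ℤ × ℤ → ℝ, InTableClass R α →
      (∀ (Y : Fin 4 → ℤ → ℝ → ℝ) (τ : ℝ), (∀ (j : Fin 4) (k : ℤ), 1 ≤ k → 0 ≤ Y j k τ) →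
        ∀ δ : ℝ, 0 < δ → ∀ (i : Fin 4) (n : ℤ), 1 ≤ n → Y i n τ = 0 → 0 ≤ quadTerm δ α Y i n τ) →
      ∀ X₀ : Fin 4 → ℝ, ∃ η : ℝ, 0 < η ∧ ∀ T : ℝ, 0 < T → ∃ C : ℝ, ∀ ν : ℝ, 0 < ν →
      ∀ s ∈ Ioc (0 : ℝ) T, ∀ X : Fin 4 → ℤ → ℝ → ℝ,
      (∀ i k, X i k 0 = if k = 0 then X₀ i else 0) →
      (∀ i k, k < 0 → ∀ t, X i k t = 0) →
      (∃ M : ℝ, ∀ (t : ℝ) (i : Fin 4) (k : ℤ), (1 + (1 + ε₀) ^ ((10 : ℝ) * k)) * |X i k t| ≤ M) →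
      (∀ i k, Continuous (X i k)) →
      (∀ i k, ∀ t ∈ Icc (0 : ℝ) s, HasDerivWithinAt (X i k)
        (quadTerm ε₀ α X i k t - ν * (1 + ε₀) ^ ((2 : ℝ) * k) * X i k t) (Icc 0 s) t) →
      ∀ n N : ℕ, n ≤ N → ∀ t ∈ Icc (0 : ℝ) s,
        ∑ k ∈ Finset.Icc n N, ∑ i, (1 / 2) * X i (k : ℤ) t ^ 2 ≤
          C * (1 + ε₀) ^ (-((1 + η) * (n : ℝ))) := by
  intro R hR
  obtain ⟨εs, hεs, H⟩ := viscousTailEnvelope_orthantHalf_of_ceilingOn (fun _ => True)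
    (fun R hR ε₀ hε₀ hle α _ => (SubOnsagerCeiling.orthantTailCeiling_iff_ceilingAt.1 hceil)
      R hR ε₀ hε₀ hle α) R hR
  exact ⟨εs, hεs, fun ε₀ hε₀ hle α hα hK X₀ => H ε₀ hε₀ hle α hα hK trivial X₀⟩

/-- **Glue of the orthant/sign-mixing split of A‴.** If the clause of `ViscousTailEnvelope` holds
(with its own threshold `εs₁(R)`) for the ORTHANT tables of every `E₂(R)` — those satisfying the
Kamke quasi-positivity condition — and (with threshold `εs₂(R)`) for the SIGN-MIXING tables — those
violating it — then `ViscousTailEnvelope` holds, with `εs = min εs₁ εs₂` (case split on the orthant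
predicate, as in `SubOnsagerCeiling.closes`).  Pure logic; MODEL lattice statement. [this file] -/
theorem viscousTailEnvelope_of_orthantHalf_of_mixingHalf
    (hO : ∀ R : ℝ, 1 ≤ R → ∃ εs : ℝ, 0 < εs ∧ ∀ ε₀ : ℝ, 0 < ε₀ → ε₀ ≤ εs →
      ∀ α : Fin 4 → Fin 4 → Fin 4 → ℤ × ℤ × ℤ → ℝ, InTableClass R α →
      (∀ (Y : Fin 4 → ℤ → ℝ → ℝ) (τ : ℝ), (∀ (j : Fin 4) (k : ℤ), 1 ≤ k → 0 ≤ Y j k τ) →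
        ∀ δ : ℝ, 0 < δ → ∀ (i : Fin 4) (n : ℤ), 1 ≤ n → Y i n τ = 0 → 0 ≤ quadTerm δ α Y i n τ) →
      ∀ X₀ : Fin 4 → ℝ, ∃ η : ℝ, 0 < η ∧ ∀ T : ℝ, 0 < T → ∃ C : ℝ, ∀ ν : ℝ, 0 < ν →
      ∀ s ∈ Ioc (0 : ℝ) T, ∀ X : Fin 4 → ℤ → ℝ → ℝ,
      (∀ i k, X i k 0 = if k = 0 then X₀ i else 0) →
      (∀ i k, k < 0 → ∀ t, X i k t = 0) →
      (∃ M : ℝ, ∀ (t : ℝ) (i : Fin 4) (k : ℤ), (1 + (1 + ε₀) ^ ((10 : ℝ) * k)) * |X i k t| ≤ M) →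
      (∀ i k, Continuous (X i k)) →
      (∀ i k, ∀ t ∈ Icc (0 : ℝ) s, HasDerivWithinAt (X i k)
        (quadTerm ε₀ α X i k t - ν * (1 + ε₀) ^ ((2 : ℝ) * k) * X i k t) (Icc 0 s) t) →
      ∀ n N : ℕ, n ≤ N → ∀ t ∈ Icc (0 : ℝ) s,
        ∑ k ∈ Finset.Icc n N, ∑ i, (1 / 2) * X i (k : ℤ) t ^ 2 ≤
          C * (1 + ε₀) ^ (-((1 + η) * (n : ℝ))))
    (hM : ∀ R : ℝ, 1 ≤ R → ∃ εs : ℝ, 0 < εs ∧ ∀ ε₀ : ℝ, 0 < ε₀ → ε₀ ≤ εs →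
      ∀ α : Fin 4 → Fin 4 → Fin 4 → ℤ × ℤ × ℤ → ℝ, InTableClass R α →
      ¬ (∀ (Y : Fin 4 → ℤ → ℝ → ℝ) (τ : ℝ), (∀ (j : Fin 4) (k : ℤ), 1 ≤ k → 0 ≤ Y j k τ) →
        ∀ δ : ℝ, 0 < δ → ∀ (i : Fin 4) (n : ℤ), 1 ≤ n → Y i n τ = 0 → 0 ≤ quadTerm δ α Y i n τ) →
      ∀ X₀ : Fin 4 → ℝ, ∃ η : ℝ, 0 < η ∧ ∀ T : ℝ, 0 < T → ∃ C : ℝ, ∀ ν : ℝ, 0 < ν →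
      ∀ s ∈ Ioc (0 : ℝ) T, ∀ X : Fin 4 → ℤ → ℝ → ℝ,
      (∀ i k, X i k 0 = if k = 0 then X₀ i else 0) →
      (∀ i k, k < 0 → ∀ t, X i k t = 0) →
      (∃ M : ℝ, ∀ (t : ℝ) (i : Fin 4) (k : ℤ), (1 + (1 + ε₀) ^ ((10 : ℝ) * k)) * |X i k t| ≤ M) →
      (∀ i k, Continuous (X i k)) →
      (∀ i k, ∀ t ∈ Icc (0 : ℝ) s, HasDerivWithinAt (X i k)
        (quadTerm ε₀ α X i k t - ν * (1 + ε₀) ^ ((2 : ℝ) * k) * X i k t) (Icc 0 s) t) →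
      ∀ n N : ℕ, n ≤ N → ∀ t ∈ Icc (0 : ℝ) s,
        ∑ k ∈ Finset.Icc n N, ∑ i, (1 / 2) * X i (k : ℤ) t ^ 2 ≤
          C * (1 + ε₀) ^ (-((1 + η) * (n : ℝ)))) :
    SubcriticalEnvelope.ViscousTailEnvelope := by
  intro R hR
  obtain ⟨ε₁, hε₁, H₁⟩ := hO R hR
  obtain ⟨ε₂, hε₂, H₂⟩ := hM R hR
  refine ⟨min ε₁ ε₂, lt_min hε₁ hε₂, fun ε₀ hε₀ hle α hα X₀ => ?_⟩
  by_cases hK : (∀ (Y : Fin 4 → ℤ → ℝ → ℝ) (τ : ℝ), (∀ (j : Fin 4) (k : ℤ), 1 ≤ k → 0 ≤ Y j k τ) →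
      ∀ δ : ℝ, 0 < δ → ∀ (i : Fin 4) (n : ℤ), 1 ≤ n → Y i n τ = 0 → 0 ≤ quadTerm δ α Y i n τ)
  · exact H₁ ε₀ hε₀ (hle.trans (min_le_left _ _)) α hα hK X₀
  · exact H₂ ε₀ hε₀ (hle.trans (min_le_right _ _)) α hα hK X₀

/-- **A‴ from `OrthantTailCeiling` and the sign-mixing half.** The sibling crux
`SubOnsagerCeiling.OrthantTailCeiling` (stmt-25507) together with the sign-mixing half of the
envelope (the clause of `ViscousTailEnvelope` for the tables of `E₂(R)` violating the Kamke orthant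
condition, below some threshold `εs₂(R)`) gives `ViscousTailEnvelope` — i.e. modulo 25507 the crux
A‴ reduces to its sign-mixing conjunct.  MODEL lattice statement; both hypotheses are open.
[this file] -/
theorem viscousTailEnvelope_of_orthantTailCeiling_of_mixingHalf
    (hceil : SubOnsagerCeiling.OrthantTailCeiling)
    (hM : ∀ R : ℝ, 1 ≤ R → ∃ εs : ℝ, 0 < εs ∧ ∀ ε₀ : ℝ, 0 < ε₀ → ε₀ ≤ εs →
      ∀ α : Fin 4 → Fin 4 → Fin 4 → ℤ × ℤ × ℤ → ℝ, InTableClass R α →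
      ¬ (∀ (Y : Fin 4 → ℤ → ℝ → ℝ) (τ : ℝ), (∀ (j : Fin 4) (k : ℤ), 1 ≤ k → 0 ≤ Y j k τ) →
        ∀ δ : ℝ, 0 < δ → ∀ (i : Fin 4) (n : ℤ), 1 ≤ n → Y i n τ = 0 → 0 ≤ quadTerm δ α Y i n τ) →
      ∀ X₀ : Fin 4 → ℝ, ∃ η : ℝ, 0 < η ∧ ∀ T : ℝ, 0 < T → ∃ C : ℝ, ∀ ν : ℝ, 0 < ν →
      ∀ s ∈ Ioc (0 : ℝ) T, ∀ X : Fin 4 → ℤ → ℝ → ℝ,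
      (∀ i k, X i k 0 = if k = 0 then X₀ i else 0) →
      (∀ i k, k < 0 → ∀ t, X i k t = 0) →
      (∃ M : ℝ, ∀ (t : ℝ) (i : Fin 4) (k : ℤ), (1 + (1 + ε₀) ^ ((10 : ℝ) * k)) * |X i k t| ≤ M) →
      (∀ i k, Continuous (X i k)) →
      (∀ i k, ∀ t ∈ Icc (0 : ℝ) s, HasDerivWithinAt (X i k)
        (quadTerm ε₀ α X i k t - ν * (1 + ε₀) ^ ((2 : ℝ) * k) * X i k t) (Icc 0 s) t) →
      ∀ n N : ℕ, n ≤ N → ∀ t ∈ Icc (0 : ℝ) s,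
        ∑ k ∈ Finset.Icc n N, ∑ i, (1 / 2) * X i (k : ℤ) t ^ 2 ≤
          C * (1 + ε₀) ^ (-((1 + η) * (n : ℝ)))) :
    SubcriticalEnvelope.ViscousTailEnvelope :=
  viscousTailEnvelope_of_orthantHalf_of_mixingHalf
    (viscousTailEnvelope_orthantHalf_of_orthantTailCeiling hceil) hM

end Summit.NavierStokesRegularity.NavierStokesRegularity.Theorems

end
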